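import Mathlib
import Literature.NumberTheory.LFunctions.HurwitzZetaConstantTerm
import HarnessLib

/-!
# `ζ(s,x) = 1/(s−1) − Γ'/Γ(x) + O(s−1)`: Theorem 22.2 with the rate (Murty–Rath, Ch. 22)

Topic `Literature/NumberTheory/LFunctions`; namespace `Literature.NumberTheory.LFunctions.HurwitzZetaOne` (continued
from `HurwitzZetaConstantTerm.lean`, P1 g56; kept in its own leaf to respect the 400-line bound). THEOREMS only
(no definition, no named fact, no `sorry`); cell pub-zeta5, P1 g56.

Murty–Rath, *Transcendental Numbers* [MurtyRath2014], Ch. 22, Theorem 22.2 (p. 125): «`lim_{s→1⁺} ζ(s,x) − 1/(s−1)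
= −Γ'(x)/Γ(x)`», i.e. the constant term of the Laurent expansion of `ζ(s,x)` at its simple pole. Here the expansion
is recorded TO FIRST ORDER WITH THE RATE, which the meromorphy gives for free:

* **`isBigO_hurwitzZeta_sub_one_div_add_digamma`** — for real `0 < x ≤ 1`,
  `ζ(s,x) − 1/(s−1) + ψ(x) = O(s−1)` on `𝓝[≠] 1` (Mathlib's `differentiableAt_hurwitzZeta_sub_one_div` —
  `ζ(s,x) − 1/((s−1)Γ_ℝ(s))` is differentiable at `1` — plus the analytic difference quotient of the entire `1/Γ_ℝ`
  (`dslope`); the left-over constant vanishes by Theorem 22.2, `tendsto_hurwitzZeta_sub_one_div`);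
* **`isBigO_riemannZeta_sub_one_div_sub_eulerMascheroni`** — `ζ(s) − 1/(s−1) − γ = O(s−1)` (the case `x = 1`;
  Mathlib has the limit `tendsto_riemannZeta_sub_one_div` and the `O(1)` bound `isBigO_riemannZeta_sub_one_div`).

HONEST FRAMING: textbook identities made kernel theorems; nothing here concerns `ζ(5)`.
-/

noncomputable section

open Complex Filter Topology Finset HurwitzZeta Asymptotics

namespace Literature.NumberTheory.LFunctions.HurwitzZetaOne

/-- `ζ(s, 1)` in Mathlib's `UnitAddCircle` parametrisation is the Riemann zeta function (`1 = 0` in `ℝ/ℤ`).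
[folklore] -/
private theorem hurwitzZeta_coe_one' : hurwitzZeta ((1 : ℝ) : UnitAddCircle) = riemannZeta := by
  rw [show ((1 : ℝ) : UnitAddCircle) = 0 from AddCircle.coe_period (1 : ℝ), hurwitzZeta_zero]

/-! ### The first-order Laurent expansion at the pole -/

/-- **Theorem 22.2 with the rate: `ζ(s,x) = 1/(s−1) − Γ'/Γ(x) + O(s−1)` at `s = 1`.** For real `0 < x ≤ 1`,
`(s ↦ ζ(s,x) − 1/(s−1) + ψ(x)) = O(s−1)` on the punctured neighbourhood of `1`: Mathlib's
`differentiableAt_hurwitzZeta_sub_one_div` (`ζ(s,x) − 1/((s−1)Γ_ℝ(s))` is differentiable at `1`) and the analytic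
difference quotient `(1/Γ_ℝ(s) − 1)/(s−1)` (`dslope` of the entire `1/Γ_ℝ`) give the two `O(s−1)` pieces; the
constant left over vanishes by Theorem 22.2 (`tendsto_hurwitzZeta_sub_one_div`).
[cite: MurtyRath2014, Ch. 22, Theorem 22.2 (p. 125)] -/
theorem isBigO_hurwitzZeta_sub_one_div_add_digamma {x : ℝ} (hx0 : 0 < x) (hx1 : x ≤ 1) :
    (fun s : ℂ => hurwitzZeta (x : UnitAddCircle) s - 1 / (s - 1) + Complex.digamma x) =O[𝓝[≠] 1]
      (fun s : ℂ => s - 1) := by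
  -- the two differentiable pieces
  set F : ℂ → ℂ := fun s => hurwitzZeta (x : UnitAddCircle) s - 1 / (s - 1) / Gammaℝ s with hFdef
  have hF : DifferentiableAt ℂ F 1 := differentiableAt_hurwitzZeta_sub_one_div _
  set E : ℂ → ℂ := fun s => (Gammaℝ s)⁻¹ with hEdef
  have hE : Differentiable ℂ E := differentiable_Gammaℝ_inv
  have hE1 : E 1 = 1 := by simp [hEdef, Gammaℝ_one]
  have hD : DifferentiableAt ℂ (dslope E 1) 1 := by
    obtain ⟨p, hp⟩ := hE.analyticAt 1
    exact hp.has_fpower_series_dslope_fslope.analyticAt.differentiableAt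
  -- the decomposition off `s = 1`
  have hdec : ∀ s : ℂ, s ≠ 1 → hurwitzZeta (x : UnitAddCircle) s - 1 / (s - 1) + Complex.digamma x =
      (F s - F 1) + (dslope E 1 s - dslope E 1 1) + (F 1 + dslope E 1 1 + Complex.digamma x) := by
    intro s hs
    rw [dslope_of_ne _ hs, slope_def_field, hE1]
    simp only [hFdef, hEdef, sub_self, div_zero, zero_div, sub_zero]
    ring
  -- the constant vanishes: the left side and the two brackets tend to `0`
  have hlim0 : Tendsto (fun s : ℂ => hurwitzZeta (x : UnitAddCircle) s - 1 / (s - 1) + Complex.digamma x)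
      (𝓝[≠] 1) (𝓝 0) := by
    have h := (tendsto_hurwitzZeta_sub_one_div hx0 hx1).add_const (Complex.digamma x)
    rwa [neg_add_cancel] at h
  have hR : Tendsto (fun s : ℂ => (F s - F 1) + (dslope E 1 s - dslope E 1 1)) (𝓝[≠] 1) (𝓝 0) := by
    have h1 : Tendsto (fun s : ℂ => F s - F 1) (𝓝[≠] 1) (𝓝 0) := by
      have h := ((hF.continuousAt.tendsto).sub_const (F 1)).mono_left (nhdsWithin_le_nhds (s := ({1}ᶜ : Set ℂ)))
      rwa [sub_self] at h
    have h2 : Tendsto (fun s : ℂ => dslope E 1 s - dslope E 1 1) (𝓝[≠] 1) (𝓝 0) := by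
      have h := ((hD.continuousAt.tendsto).sub_const (dslope E 1 1)).mono_left
        (nhdsWithin_le_nhds (s := ({1}ᶜ : Set ℂ)))
      rwa [sub_self] at h
    have h := h1.add h2
    rwa [add_zero] at h
  have hC : F 1 + dslope E 1 1 + Complex.digamma x = 0 := by
    have h := hlim0.sub hR
    rw [sub_zero] at h
    have hconst : Tendsto (fun _ : ℂ => F 1 + dslope E 1 1 + Complex.digamma x) (𝓝[≠] (1 : ℂ)) (𝓝 0) := by
      refine h.congr' ?_
      filter_upwards [self_mem_nhdsWithin] with s hs
      rw [hdec s hs]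
      ring
    exact tendsto_nhds_unique tendsto_const_nhds hconst
  -- conclude
  have h1 : (fun s : ℂ => F s - F 1) =O[𝓝[≠] 1] (fun s : ℂ => s - 1) :=
    hF.isBigO_sub.mono nhdsWithin_le_nhds
  have h2 : (fun s : ℂ => dslope E 1 s - dslope E 1 1) =O[𝓝[≠] 1] (fun s : ℂ => s - 1) :=
    hD.isBigO_sub.mono nhdsWithin_le_nhds
  refine (h1.add h2).congr' ?_ Filter.EventuallyEq.rfl
  filter_upwards [self_mem_nhdsWithin] with s hs
  rw [hdec s hs, hC, add_zero]

/-- **`ζ(s) = 1/(s−1) + γ + O(s−1)`** — the case `x = 1` (`ψ(1) = −γ`): the first-order Laurent expansion of the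
Riemann zeta function at its pole (Mathlib has the limit `tendsto_riemannZeta_sub_one_div` and the `O(1)` bound
`isBigO_riemannZeta_sub_one_div`). [cite: MurtyRath2014, Ch. 22, p. 125 (`lim_{s→1⁺} ζ(s) − 1/(s−1) = γ`)] -/
theorem isBigO_riemannZeta_sub_one_div_sub_eulerMascheroni :
    (fun s : ℂ => riemannZeta s - 1 / (s - 1) - Real.eulerMascheroniConstant) =O[𝓝[≠] 1]
      (fun s : ℂ => s - 1) := by
  have h := isBigO_hurwitzZeta_sub_one_div_add_digamma (x := 1) one_pos le_rfl
  simp only [Complex.ofReal_one, Complex.digamma_one, hurwitzZeta_coe_one'] at h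
  refine h.congr' (Filter.Eventually.of_forall fun s => ?_) Filter.EventuallyEq.rfl
  ring

end Literature.NumberTheory.LFunctions.HurwitzZetaOne

end
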